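import Summits.CriticalPhenomena.PercolationContinuityZ3.Theorems.Transplant.KNCells2ChainAppend
import Summits.CriticalPhenomena.PercolationContinuityZ3.Theorems.Transplant.KNCells2ChainBandR
import Summits.CriticalPhenomena.PercolationContinuityZ3.Theorems.Transplant.KNCellsBoxProdZ2RootRun
import HarnessLib

/-!
# D″ node, (F) part 11a, PLANAR (DPRIME-SCOPE §2 L6′, M.9, R1 = p3 05:53:45Z (C)/(E), stmt-g9 06:21:14Z strides of record; hp-8 column):
# the (F) PLANAR SCHEDULE OF RECORD about a point `pc` along `du` — TWO rooted band runs (p1-g9's `Band.scheduleR`), APPENDED (p5-g6's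
# `Schedule.append`): a SHORT-stride prefix (start SEGMENT `q = 0` at the first hop's landing level `pc + σ·ℓ1`, half-width `q'₁`, stride
# `s₁`, `N₁ + 1` steps) followed by the LONG-stride run (stride `s₂`, `N₂ + 1` steps) starting from the prefix's last core; pure `Site 2`
# geometry, no cells: the levels of every region relative to `pc` (`≥ ℓ1 − (s₁ + 2R')`, so a seed in `pc + Λ_{Mz}` with
# `Mz + s₁ + 2R' < ℓ1` sits below the chain), the last core, the `ℓ¹`-reach of the cores, the landing half-side in core `0`

builds on p205010 (kernel theorem, internal audit signed; external expert review pending) — nothing in this file uses p205010.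
Lane `prim-bschramm`, seat `prim-hp-8` (gen 30; L6′ (F) owner); helper file (`--supports stmt-CriticalPhenomena-4575`).
* `FaceRun.TwoBandOK` (the two `Band.BandOK`s with the joined half-width, `s₂ ≤ (N₁ + 2) s₁`), `FaceRun.ctr₁/ctr₂`, `FaceRun.core_join`,
  **`FaceRun.schedule`** `:= (Band.scheduleR … ctr₁ ok₁ …).append (Band.scheduleR … ctr₂ ok₂ …)`; readings `schedule_N/_R'/_ax/_params`;
* `mem_core_zero_of_landing`, **`lev_ge_of_mem_region`**, `lev_le_of_mem_region`, `trans_le_of_mem_region`, **`schedule_core_last`**,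
  `lev_core_last`, **`reach_of_mem_core_succ`**.
[cite: KozmaNitzan2024, §4 Lemma 11 (pp. 22–23: the slabs, the first cube), p. 30 (Step III)]
-/

noncomputable section

namespace Summit.CriticalPhenomena.PercolationContinuityZ3.Theorems

namespace Transplant

namespace ChainPlanar

namespace FaceRun

open Literature.Probability.Percolation Literature.Probability.LatticeModels
open Literature.Probability.Percolation.KozmaNitzan
open Literature.Probability.Percolation.KozmaNitzan.Cells (oth oth_ne eq_oth_of_ne sgOf sgOf_sign)
open BoxProdZ2 (rootCtr rootCtr_fst rootCtr_oth)
open PCells (mem_psBox_iff)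

/-- **Admissible parameters of the (F) schedule of record**: the prefix band (`q = 0`, half-width `q'₁`, stride `s₁`) and the long band
(`q = 0`, half-width the prefix's last core's, stride `s₂ ≤ (N₁ + 2) s₁`). [this work] -/
structure TwoBandOK (q'₁ s₁ ρ₁ : ℤ) (R' ℓ₀₁ N₁ WM₁ : ℕ) (Wb₁ : ℕ → ℕ) (s₂ ρ₂ : ℤ) (ℓ₀₂ N₂ WM₂ : ℕ) (Wb₂ : ℕ → ℕ) : Prop where
  /-- the prefix band is admissible -/
  ok₁ : Band.BandOK 0 q'₁ s₁ ρ₁ R' ℓ₀₁ N₁ WM₁ Wb₁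
  /-- the long band, started from the prefix's last core, is admissible -/
  ok₂ : Band.BandOK 0 (q'₁ + R' + WM₁ + (N₁ : ℤ) * R') s₂ ρ₂ R' ℓ₀₂ N₂ WM₂ Wb₂
  /-- the long band's region `0` reaches no lower than the prefix's -/
  h12 : s₂ ≤ ((N₁ : ℤ) + 2) * s₁

/-- Centre of the prefix band: `pc` moved to the landing level `ℓ1` along `du`. [folklore] -/
def ctr₁ (du : MDir) (pc : Site 2) (ℓ1 : ℤ) : Site 2 := pc + rootCtr du ℓ1 0

/-- Centre of the long band: the prefix's last core's level `ℓ1 + (N₁ + 1) s₁`. [folklore] -/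
def ctr₂ (du : MDir) (pc : Site 2) (ℓ1 s₁ : ℤ) (N₁ : ℕ) : Site 2 := pc + rootCtr du (ℓ1 + ((N₁ : ℤ) + 1) * s₁) 0

section

variable (du : MDir) (pc : Site 2) (ℓ1 : ℤ) {q'₁ s₁ ρ₁ : ℤ} {R' ℓ₀₁ N₁ WM₁ : ℕ} {Wb₁ : ℕ → ℕ} {s₂ ρ₂ : ℤ} {ℓ₀₂ N₂ WM₂ : ℕ}
  {Wb₂ : ℕ → ℕ}

/-- The prefix centre along the axis. [folklore] -/
@[simp] theorem ctr₁_fst : ctr₁ du pc ℓ1 du.1 = pc du.1 + sgOf du * ℓ1 := by simp [ctr₁]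

/-- The prefix centre across the axis. [folklore] -/
@[simp] theorem ctr₁_oth : ctr₁ du pc ℓ1 (oth du.1) = pc (oth du.1) := by simp [ctr₁]

/-- The long band's centre along the axis. [folklore] -/
@[simp] theorem ctr₂_fst : ctr₂ du pc ℓ1 s₁ N₁ du.1 = pc du.1 + sgOf du * (ℓ1 + ((N₁ : ℤ) + 1) * s₁) := by simp [ctr₂]

/-- The long band's centre across the axis. [folklore] -/
@[simp] theorem ctr₂_oth : ctr₂ du pc ℓ1 s₁ N₁ (oth du.1) = pc (oth du.1) := by simp [ctr₂]

/-- `σ² = 1` for the sign of a direction. [folklore] -/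
theorem sgOf_mul_sgOf : sgOf du * sgOf du = 1 := by
  rcases sgOf_sign du with h | h <;> rw [h] <;> norm_num

/-- Signed levels relative to a centre moved by `σ X` along the axis. [folklore] -/
theorem lev_shift (y p X : ℤ) : sgOf du * (y - (p + sgOf du * X)) = sgOf du * (y - p) - X := by
  rcases sgOf_sign du with h | h <;> rw [h] <;> ring

/-- **The cores join**: the long band's start segment is the prefix's last core. [folklore] -/
theorem core_join : Band.core 0 (q'₁ + R' + WM₁ + (N₁ : ℤ) * R') s₂ R' WM₂ du.1 (sgOf du) (ctr₂ du pc ℓ1 s₁ N₁) 0 =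
    Band.core 0 q'₁ s₁ R' WM₁ du.1 (sgOf du) (ctr₁ du pc ℓ1) (N₁ + 1) := by
  obtain ⟨⟨e0α, e0β, e0W⟩, -⟩ := Band.core_params (q := (0 : ℤ)) (q' := q'₁ + R' + WM₁ + (N₁ : ℤ) * R') (s₁ := s₂) (R' := R') (WM := WM₂)
  obtain ⟨-, eF⟩ := Band.core_params (q := (0 : ℤ)) (q' := q'₁) (s₁ := s₁) (R' := R') (WM := WM₁)
  obtain ⟨eα, eβ, eW⟩ := eF (N₁ + 1) (by omega)
  rw [Band.core, Band.core, e0α, e0β, e0W, eα, eβ, eW, Band.w₁]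
  ext y
  rw [mem_psBox_iff, mem_psBox_iff, ctr₂_fst, ctr₂_oth, ctr₁_fst, ctr₁_oth, lev_shift, lev_shift]
  push_cast
  constructor
  · rintro ⟨⟨h1, h2⟩, h3, h4⟩
    exact ⟨⟨by linarith, by linarith⟩, by linarith, by linarith⟩
  · rintro ⟨⟨h1, h2⟩, h3, h4⟩
    exact ⟨⟨by linarith, by linarith⟩, by linarith, by linarith⟩

variable {du pc ℓ1}
variable (h : TwoBandOK q'₁ s₁ ρ₁ R' ℓ₀₁ N₁ WM₁ Wb₁ s₂ ρ₂ ℓ₀₂ N₂ WM₂ Wb₂) {ℓ₁₁ ℓ₁₂ : ℕ} (hℓ₁ : 2 * 0 + s₁ + R' ≤ ℓ₁₁)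
  (hℓ₂ : 2 * 0 + s₂ + R' ≤ ℓ₁₂)

/-- **THE (F) SCHEDULE OF RECORD about `pc` along `du`**: prefix band then long band, appended at the prefix's last core.
[cite: KozmaNitzan2024, §4 Lemma 11 (pp. 22–23)] -/
def schedule (du : MDir) (pc : Site 2) (ℓ1 : ℤ) (h : TwoBandOK q'₁ s₁ ρ₁ R' ℓ₀₁ N₁ WM₁ Wb₁ s₂ ρ₂ ℓ₀₂ N₂ WM₂ Wb₂) {ℓ₁₁ ℓ₁₂ : ℕ}
    (hℓ₁ : 2 * 0 + s₁ + R' ≤ ℓ₁₁) (hℓ₂ : 2 * 0 + s₂ + R' ≤ ℓ₁₂) : Schedule :=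
  (Band.scheduleR du.1 (sgOf_sign du) (ctr₁ du pc ℓ1) h.ok₁ hℓ₁).append (Band.scheduleR du.1 (sgOf_sign du) (ctr₂ du pc ℓ1 s₁ N₁) h.ok₂ hℓ₂)
    rfl (core_join du pc ℓ1)

/-- The numeric data of the schedule of record. [folklore] -/
theorem schedule_params : (schedule du pc ℓ1 h hℓ₁ hℓ₂).N = N₁ + 1 + N₂ ∧ (schedule du pc ℓ1 h hℓ₁ hℓ₂).R' = R' ∧
    (schedule du pc ℓ1 h hℓ₁ hℓ₂).ℓ₀ = min ℓ₀₁ ℓ₀₂ ∧ (schedule du pc ℓ1 h hℓ₁ hℓ₂).ℓ₁ = max ℓ₁₁ ℓ₁₂ := ⟨rfl, rfl, rfl, rfl⟩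

/-- The number of steps. [folklore] -/
@[simp] theorem schedule_N : (schedule du pc ℓ1 h hℓ₁ hℓ₂).N = N₁ + 1 + N₂ := rfl

/-- The neighbourhood radius. [folklore] -/
@[simp] theorem schedule_R' : (schedule du pc ℓ1 h hℓ₁ hℓ₂).R' = R' := rfl

/-- Every step runs along `du`. [folklore] -/
theorem schedule_ax {k : ℕ} (hk : k ≤ N₁ + 1 + N₂) : (schedule du pc ℓ1 h hℓ₁ hℓ₂).ax k = du.1 := by
  by_cases hk₁ : k ≤ N₁
  · exact Schedule.append_ax_left _ _ _ _ (by exact hk₁)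
  · obtain ⟨i, rfl⟩ : ∃ i, k = N₁ + 1 + i := ⟨k - (N₁ + 1), by omega⟩
    exact Schedule.append_ax_right _ _ _ _ i

/-- Regions of the prefix. [folklore] -/
theorem schedule_region_left {k : ℕ} (hk : k ≤ N₁) :
    (schedule du pc ℓ1 h hℓ₁ hℓ₂).region k = Band.regionR 0 s₁ ρ₁ R' du.1 (sgOf du) (ctr₁ du pc ℓ1) k :=
  Schedule.append_region_left _ _ _ _ hk

/-- Regions of the long band. [folklore] -/
theorem schedule_region_right (i : ℕ) :
    (schedule du pc ℓ1 h hℓ₁ hℓ₂).region (N₁ + 1 + i) = Band.regionR 0 s₂ ρ₂ R' du.1 (sgOf du) (ctr₂ du pc ℓ1 s₁ N₁) i :=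
  Schedule.append_region_right _ _ _ _ i

/-- Cores of the prefix (including the joint). [folklore] -/
theorem schedule_core_left {k : ℕ} (hk : k ≤ N₁ + 1) :
    (schedule du pc ℓ1 h hℓ₁ hℓ₂).core k = Band.core 0 q'₁ s₁ R' WM₁ du.1 (sgOf du) (ctr₁ du pc ℓ1) k :=
  Schedule.append_core_left' _ _ _ _ hk

/-- Cores of the long band. [folklore] -/
theorem schedule_core_right (i : ℕ) :
    (schedule du pc ℓ1 h hℓ₁ hℓ₂).core (N₁ + 1 + i) = Band.core 0 (q'₁ + R' + WM₁ + (N₁ : ℤ) * R') s₂ R' WM₂ du.1 (sgOf du) (ctr₂ du pc ℓ1 s₁ N₁) i :=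
  Schedule.append_core_right _ _ _ _ i

/-- **The landing half-side lies in core `0`**: a point at signed level `ℓ1` from `pc`, within `q'₁` of `pc` across. [folklore] -/
theorem mem_core_zero_of_landing {y : Site 2} (h1 : y du.1 - pc du.1 = sgOf du * ℓ1) (h2 : |y (oth du.1) - pc (oth du.1)| ≤ q'₁) :
    y ∈ (schedule du pc ℓ1 h hℓ₁ hℓ₂).core 0 := by
  rw [schedule_core_left h hℓ₁ hℓ₂ (Nat.zero_le _), Band.core]
  obtain ⟨⟨e0α, e0β, e0W⟩, -⟩ := Band.core_params (q := (0 : ℤ)) (q' := q'₁) (s₁ := s₁) (R' := R') (WM := WM₁)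
  rw [e0α, e0β, e0W, mem_psBox_iff, ctr₁_fst, ctr₁_oth, lev_shift]
  have hσ := sgOf_mul_sgOf du
  have h2' := abs_le.1 h2
  have h1' : sgOf du * (y du.1 - pc du.1) = ℓ1 := by rw [h1, ← mul_assoc, hσ, one_mul]
  refine ⟨⟨?_, ?_⟩, by linarith [h2'.1], by linarith [h2'.2]⟩ <;> linarith

/-- **Every region point lies at signed level `≥ ℓ1 − (s₁ + 2R')` from `pc`** (the rooted regions start above a seed in `pc + Λ_{Mz}` once
`Mz + s₁ + 2R' < ℓ1`). [cite: KozmaNitzan2024, §4 Lemma 11 (p. 22: the first cube)] -/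
theorem lev_ge_of_mem_region {k : ℕ} (hk : k ≤ N₁ + 1 + N₂) {y : Site 2} (hy : y ∈ (schedule du pc ℓ1 h hℓ₁ hℓ₂).region k) :
    ℓ1 - (s₁ + 2 * R') ≤ sgOf du * (y du.1 - pc du.1) := by
  have hσ := sgOf_mul_sgOf du
  have hs := h.ok₁.hs; have hs2 := h.ok₁.hs2; have h12 := h.h12
  have hR0 : (0 : ℤ) ≤ R' := by positivity
  by_cases hk₁ : k ≤ N₁
  · rw [schedule_region_left h hℓ₁ hℓ₂ hk₁] at hy
    have hy' := Band.regionR_subset_prism (sgOf_sign du) (ctr₁ du pc ℓ1) h.ok₁ hk₁ hy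
    rw [mem_psBox_iff, ctr₁_fst, Adv.ρ₀, lev_shift] at hy'
    linarith [hy'.1.1]
  · obtain ⟨i, rfl⟩ : ∃ i, k = N₁ + 1 + i := ⟨k - (N₁ + 1), by omega⟩
    rw [schedule_region_right h hℓ₁ hℓ₂ i] at hy
    have hy' := Band.regionR_subset_prism (sgOf_sign du) (ctr₂ du pc ℓ1 s₁ N₁) h.ok₂ (by omega) hy
    rw [mem_psBox_iff, ctr₂_fst, Adv.ρ₀, lev_shift] at hy'
    have hN0 : (0 : ℤ) ≤ N₁ := by positivity
    have hs0 : (0 : ℤ) ≤ s₁ := by linarith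
    nlinarith [hy'.1.1, hN0, hs0]

/-- **Every region point lies at signed level `≤ ℓ1 + (N₁ + 1) s₁ + (N₂ + 1) s₂` from `pc`.** [cite: KozmaNitzan2024, §4 Lemma 11 (p. 22: Ω)] -/
theorem lev_le_of_mem_region {k : ℕ} (hk : k ≤ N₁ + 1 + N₂) {y : Site 2} (hy : y ∈ (schedule du pc ℓ1 h hℓ₁ hℓ₂).region k) :
    sgOf du * (y du.1 - pc du.1) ≤ ℓ1 + ((N₁ : ℤ) + 1) * s₁ + ((N₂ : ℤ) + 1) * s₂ := by
  have hσ := sgOf_mul_sgOf du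
  have hs' := h.ok₂.hs; have hs2' := h.ok₂.hs2
  have hR0 : (0 : ℤ) ≤ R' := by positivity
  have hs0 : (0 : ℤ) ≤ s₂ := by linarith
  have hN0 : (0 : ℤ) ≤ N₂ := by positivity
  by_cases hk₁ : k ≤ N₁
  · rw [schedule_region_left h hℓ₁ hℓ₂ hk₁] at hy
    have hy' := Band.regionR_subset_prism (sgOf_sign du) (ctr₁ du pc ℓ1) h.ok₁ hk₁ hy
    rw [mem_psBox_iff, ctr₁_fst, lev_shift] at hy'
    nlinarith [hy'.1.2, hs0, hN0]
  · obtain ⟨i, rfl⟩ : ∃ i, k = N₁ + 1 + i := ⟨k - (N₁ + 1), by omega⟩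
    rw [schedule_region_right h hℓ₁ hℓ₂ i] at hy
    have hy' := Band.regionR_subset_prism (sgOf_sign du) (ctr₂ du pc ℓ1 s₁ N₁) h.ok₂ (by omega) hy
    rw [mem_psBox_iff, ctr₂_fst, lev_shift] at hy'
    linarith [hy'.1.2]

/-- **Every region point lies within `max ρ₁ ρ₂` of `pc` across.** [cite: KozmaNitzan2024, §4 Lemma 11 (p. 22: Ω)] -/
theorem trans_le_of_mem_region {k : ℕ} (hk : k ≤ N₁ + 1 + N₂) {y : Site 2} (hy : y ∈ (schedule du pc ℓ1 h hℓ₁ hℓ₂).region k) :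
    |y (oth du.1) - pc (oth du.1)| ≤ max ρ₁ ρ₂ := by
  rw [abs_le]
  by_cases hk₁ : k ≤ N₁
  · rw [schedule_region_left h hℓ₁ hℓ₂ hk₁] at hy
    have hy' := Band.regionR_subset_prism (sgOf_sign du) (ctr₁ du pc ℓ1) h.ok₁ hk₁ hy
    rw [mem_psBox_iff, ctr₁_oth] at hy'
    constructor <;> linarith [hy'.2.1, hy'.2.2, le_max_left ρ₁ ρ₂, neg_le_neg (le_max_left ρ₁ ρ₂)]
  · obtain ⟨i, rfl⟩ : ∃ i, k = N₁ + 1 + i := ⟨k - (N₁ + 1), by omega⟩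
    rw [schedule_region_right h hℓ₁ hℓ₂ i] at hy
    have hy' := Band.regionR_subset_prism (sgOf_sign du) (ctr₂ du pc ℓ1 s₁ N₁) h.ok₂ (by omega) hy
    rw [mem_psBox_iff, ctr₂_oth] at hy'
    constructor <;> linarith [hy'.2.1, hy'.2.2, le_max_right ρ₁ ρ₂]

/-- **The last core** is the long band's last core: the segment at signed level `ℓ1 + (N₁+1) s₁ + (N₂+1) s₂` from `pc`, half-width
`q'₁ + WM₁ + WM₂ + (N₁ + N₂ + 2) R'`. [cite: KozmaNitzan2024, §4 Lemma 11 (p. 23: the last face)] -/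
theorem schedule_core_last : (schedule du pc ℓ1 h hℓ₁ hℓ₂).core (N₁ + 1 + N₂ + 1) =
    Band.core 0 (q'₁ + R' + WM₁ + (N₁ : ℤ) * R') s₂ R' WM₂ du.1 (sgOf du) (ctr₂ du pc ℓ1 s₁ N₁) (N₂ + 1) :=
  Schedule.append_core_last _ _ _ _

/-- **Coordinates of the last core**: signed level `ℓ1 + (N₁+1) s₁ + (N₂+1) s₂`, transverse offset `≤ q'₁ + WM₁ + WM₂ + (N₁ + N₂ + 2) R'`.
[folklore] -/
theorem lev_core_last {y : Site 2} (hy : y ∈ (schedule du pc ℓ1 h hℓ₁ hℓ₂).core (N₁ + 1 + N₂ + 1)) :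
    sgOf du * (y du.1 - pc du.1) = ℓ1 + ((N₁ : ℤ) + 1) * s₁ + ((N₂ : ℤ) + 1) * s₂ ∧
      |y (oth du.1) - pc (oth du.1)| ≤ q'₁ + WM₁ + WM₂ + ((N₁ : ℤ) + N₂ + 2) * R' := by
  rw [schedule_core_last h hℓ₁ hℓ₂, Band.core] at hy
  obtain ⟨-, eF⟩ := Band.core_params (q := (0 : ℤ)) (q' := q'₁ + R' + WM₁ + (N₁ : ℤ) * R') (s₁ := s₂) (R' := R') (WM := WM₂)
  obtain ⟨eα, eβ, eW⟩ := eF (N₂ + 1) (by omega)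
  rw [eα, eβ, eW, Band.w₁, mem_psBox_iff, ctr₂_fst, ctr₂_oth, lev_shift] at hy
  obtain ⟨⟨h1, h2⟩, h3, h4⟩ := hy
  push_cast at h1 h2 h3 h4
  refine ⟨by linarith, abs_le.2 ⟨by nlinarith, by nlinarith⟩⟩

/-- **`ℓ¹`-reach of the cores**: every point of a core `k + 1` (`k ≤ N`) lies within `ℓ¹`-distance
`|ℓ1| + (N₁+1) s₁ + (N₂+1) s₂ + q'₁ + WM₁ + WM₂ + (N₁ + N₂ + 2) R'` of `pc`. [folklore] -/
theorem reach_of_mem_core_succ {k : ℕ} (hk : k ≤ N₁ + 1 + N₂) {y : Site 2} (hy : y ∈ (schedule du pc ℓ1 h hℓ₁ hℓ₂).core (k + 1)) :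
    ((y 0 - pc 0).natAbs : ℤ) + (y 1 - pc 1).natAbs ≤
      |ℓ1| + ((N₁ : ℤ) + 1) * s₁ + ((N₂ : ℤ) + 1) * s₂ + (q'₁ + WM₁ + WM₂ + ((N₁ : ℤ) + N₂ + 2) * R') := by
  have hσ := sgOf_mul_sgOf du
  have hσ' := sgOf_sign du
  have hs := h.ok₁.hs; have hs2 := h.ok₁.hs2; have hs' := h.ok₂.hs; have hs2' := h.ok₂.hs2; have hq' := h.ok₁.hq'
  have hR0 : (0 : ℤ) ≤ R' := by positivity
  have hs0 : (0 : ℤ) ≤ s₁ := by linarith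
  have hs0' : (0 : ℤ) ≤ s₂ := by linarith
  have hN0 : (0 : ℤ) ≤ N₁ := by positivity
  have hN0' : (0 : ℤ) ≤ N₂ := by positivity
  have hW0 : (0 : ℤ) ≤ WM₁ := by positivity
  have hW0' : (0 : ℤ) ≤ WM₂ := by positivity
  -- the core `k + 1` is a line core of one of the two bands
  have key : |y du.1 - pc du.1| ≤ |ℓ1| + ((N₁ : ℤ) + 1) * s₁ + ((N₂ : ℤ) + 1) * s₂ ∧
      |y (oth du.1) - pc (oth du.1)| ≤ q'₁ + WM₁ + WM₂ + ((N₁ : ℤ) + N₂ + 2) * R' := by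
    by_cases hk₁ : k + 1 ≤ N₁ + 1
    · rw [schedule_core_left h hℓ₁ hℓ₂ hk₁, Band.core] at hy
      obtain ⟨-, eF⟩ := Band.core_params (q := (0 : ℤ)) (q' := q'₁) (s₁ := s₁) (R' := R') (WM := WM₁)
      obtain ⟨eα, eβ, eW⟩ := eF (k + 1) (by omega)
      rw [eα, eβ, eW, Band.w₁, mem_psBox_iff, ctr₁_fst, ctr₁_oth, lev_shift] at hy
      obtain ⟨⟨h1, h2⟩, h3, h4⟩ := hy
      push_cast at h1 h2 h3 h4
      have hk' : ((k : ℤ) + 1) * s₁ ≤ ((N₁ : ℤ) + 1) * s₁ := mul_le_mul_of_nonneg_right (by exact_mod_cast hk₁) hs0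
      have hkN : (k : ℤ) ≤ N₁ := by exact_mod_cast (by omega : k ≤ N₁)
      have hkR : ((k : ℤ) + 1 - 1) * (R' : ℤ) ≤ (N₁ : ℤ) * R' := mul_le_mul_of_nonneg_right (by linarith) hR0
      have hNs : (0 : ℤ) ≤ ((N₂ : ℤ) + 1) * s₂ := by positivity
      have hNR : (0 : ℤ) ≤ (N₂ : ℤ) * R' := by positivity
      have hks : (0 : ℤ) ≤ ((k : ℤ) + 1) * s₁ := by positivity
      have hN1s : (0 : ℤ) ≤ ((N₁ : ℤ) + 1) * s₁ := by positivity
      constructor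
      · rw [abs_le]
        rcases hσ' with h0 | h0 <;> rw [h0] at h1 h2 <;> constructor <;>
          linarith [le_abs_self ℓ1, neg_abs_le ℓ1]
      · rw [abs_le]; constructor <;> linarith
    · obtain ⟨i, hi⟩ : ∃ i, k + 1 = N₁ + 1 + i := ⟨k + 1 - (N₁ + 1), by omega⟩
      rw [hi, schedule_core_right h hℓ₁ hℓ₂ i, Band.core] at hy
      have hi1 : 1 ≤ i := by omega
      obtain ⟨-, eF⟩ := Band.core_params (q := (0 : ℤ)) (q' := q'₁ + R' + WM₁ + (N₁ : ℤ) * R') (s₁ := s₂) (R' := R') (WM := WM₂)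
      obtain ⟨eα, eβ, eW⟩ := eF i hi1
      rw [eα, eβ, eW, Band.w₁, mem_psBox_iff, ctr₂_fst, ctr₂_oth, lev_shift] at hy
      obtain ⟨⟨h1, h2⟩, h3, h4⟩ := hy
      have hiN : (i : ℤ) ≤ (N₂ : ℤ) + 1 := by exact_mod_cast (by omega : i ≤ N₂ + 1)
      have hi' : (i : ℤ) * s₂ ≤ ((N₂ : ℤ) + 1) * s₂ := mul_le_mul_of_nonneg_right hiN hs0'
      have hiR : ((i : ℤ) - 1) * (R' : ℤ) ≤ (N₂ : ℤ) * R' := mul_le_mul_of_nonneg_right (by linarith) hR0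
      have hi0 : (0 : ℤ) ≤ (i : ℤ) * s₂ := by positivity
      have hNs : (0 : ℤ) ≤ ((N₁ : ℤ) + 1) * s₁ := by positivity
      have hNR : (0 : ℤ) ≤ (N₁ : ℤ) * R' := by positivity
      have hN2s : (0 : ℤ) ≤ ((N₂ : ℤ) + 1) * s₂ := by positivity
      constructor
      · rw [abs_le]
        rcases hσ' with h0 | h0 <;> rw [h0] at h1 h2 <;> constructor <;>
          linarith [le_abs_self ℓ1, neg_abs_le ℓ1]
      · rw [abs_le]; constructor <;> linarith
  -- `ℓ¹ ≤` sum of the two coordinate bounds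
  obtain ⟨k1, k2⟩ := key
  have e0 : ((y 0 - pc 0).natAbs : ℤ) = |y 0 - pc 0| := Int.natCast_natAbs _
  have e1 : ((y 1 - pc 1).natAbs : ℤ) = |y 1 - pc 1| := Int.natCast_natAbs _
  rw [e0, e1]
  have h01 : du.1 = 0 ∨ du.1 = 1 := by
    rcases du with ⟨i, b⟩; fin_cases i <;> simp
  rcases h01 with hd | hd
  · have ho : oth du.1 = 1 := by rw [hd]; decide
    rw [hd] at k1; rw [ho] at k2; linarith
  · have ho : oth du.1 = 0 := by rw [hd]; decide
    rw [hd] at k1; rw [ho] at k2; linarith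

end

end FaceRun

end ChainPlanar

end Transplant

end Summit.CriticalPhenomena.PercolationContinuityZ3.Theorems

end
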